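import Summits.AtomisticToContinuum.FouriersLaw.Theorems.PhononMeanFreePathIncoherentChannelOneTimeEngine
import Summits.AtomisticToContinuum.FouriersLaw.Theorems.PhononMeanFreePathChannelsBoundedResponse

/-!
# `IncoherentChannel` — route bookkeeping (lead c5): the crux implies the support item `IncoherentBounded`

Helper file (`--supports stmt-AtomisticToContinuum-11811`) of crux `PhononMeanFreePath.IncoherentChannel` (rank 3, route
`PhononMeanFreePath`, sub-problem `FouriersLaw`). Two by-name implications between items of the route file, for the planners'
book: the support item `IncoherentBounded` (stmt-AtomisticToContinuum-11815, `sup_N |a_N| < ∞`) is a formal COROLLARY of the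
crux (a convergent real sequence is bounded) — so 11815 is NECESSARY staging for 11811, and a disproof of 11815 kills the crux
(`incoherentChannel_implies_incoherentBounded`, registered; the same observation is recorded sorry-free in the disprover's
workfile `Cruxes/IncoherentChannel/Disproof.lean` §1, not importable from `Theorems/`); and, combining with the one-time engine
of this line (`coherentDephasing_of_oneTime`, p149873) and the landed partial assembly `channelsBoundedResponse_proof`
(stmt-11816), under the one-time hypothesis the crux already delivers the catalogued waypoint `BoundedResponse` (stmt-11071)
BY NAME (`boundedResponse_of_oneTime_of_incoherentChannel`). No definitions; nothing here closes an item.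
-/

noncomputable section

namespace Summit.AtomisticToContinuum.FouriersLaw.Theorems.PhononMeanFreePath

open MeasureTheory Set Filter Topology
open Summit.AtomisticToContinuum.FouriersLaw.Theses.PhononMeanFreePath

/-- **The crux implies the support item `IncoherentBounded` (stmt-AtomisticToContinuum-11815)** — registered stub
`incoherentChannel_implies_incoherentBounded`: at every admissible parameter point the crux's sequence
`a_N = N(γ²/T²)∫₀^∞(C_N − 2r_N²)` converges, hence is bounded. (adapted from `Cruxes/IncoherentChannel/Disproof.lean`,
`incoherentBounded_of_incoherentChannel`) [folklore] -/
theorem incoherentChannel_implies_incoherentBounded : IncoherentChannel → IncoherentBounded := by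
  intro h ω₂ lam β γ hω hl hβ hγ T hT
  obtain ⟨κ, -, hlim⟩ := h ω₂ lam β γ hω hl hβ hγ T hT
  obtain ⟨B₁, hB₁⟩ := hlim.bddAbove_range
  obtain ⟨B₂, hB₂⟩ := hlim.bddBelow_range
  refine ⟨max B₁ (-B₂), fun N => ?_⟩
  have h1 := hB₁ ⟨N, rfl⟩
  have h2 := hB₂ ⟨N, rfl⟩
  rw [abs_le]
  exact ⟨by linarith [le_max_right B₁ (-B₂)], h1.trans (le_max_left _ _)⟩

/-- **Under the one-time engine the crux delivers `BoundedResponse` (stmt-AtomisticToContinuum-11071) BY NAME**: the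
one-time hypothesis gives `CoherentDephasing` (`coherentDephasing_of_oneTime`), the crux gives `IncoherentBounded`
(`incoherentChannel_implies_incoherentBounded`), and the landed partial assembly `channelsBoundedResponse_proof`
(`NessUnique → BoundaryKubo → CoherentDephasing → IncoherentBounded → BoundedResponse`, stmt-11816) runs on the proved
siblings `NessUnique_holds`, `boundaryKubo_proof`. CONDITIONAL on the one-time hypothesis and on the crux. [folklore] -/
theorem boundedResponse_of_oneTime_of_incoherentChannel
    (h1 : ∀ ω₂ lam β γ : ℝ, 0 < ω₂ → 0 < lam → 0 < β → 0 < γ → ∀ T : ℝ, 0 < T →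
      ∃ η : ℝ, 0 < η ∧ η < 1 ∧ Tendsto (fun N : ℕ => (N : ℝ) * fnorm ω₂ lam β γ T N ((N : ℝ) ^ η)) atTop (𝓝 0))
    (h : IncoherentChannel) : BoundedResponse :=
  Summit.AtomisticToContinuum.FouriersLaw.Theorems.channelsBoundedResponse_proof NessUnique_holds
    Summit.AtomisticToContinuum.FouriersLaw.Theorems.PhononMeanFreePathBoundaryKubo.boundaryKubo_proof
    (coherentDephasing_of_oneTime h1) (incoherentChannel_implies_incoherentBounded h)

end Summit.AtomisticToContinuum.FouriersLaw.Theorems.PhononMeanFreePath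

end
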